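import Summits.BirchSwinnertonDyer.BirchSwinnertonDyer.Theses.GenusKolyvaginAtTwo
import Literature.NumberTheory.EllipticCurves.BSDSelmerPParityProofs
import HarnessLib

/-!
# SKELETON LINE `monsky_byname` for item 23327 `TwoParityDD` (route GenusKolyvaginAtTwo — the 2-parity theorem `(-1)^{s₂(E)} = w(E)` for all E/ℚ)

line-writer skeleton (linewriter-bsd-genuskolyattwo-1 g0); NOT leaf progress. PRINT-ONLY ITEM (census: no research content) — registered anyway so
that the exact printed inputs are typed BY NAME for a typer/prover hand: `TwoParityDD` = `∀ V, p_parity V 2` = `(-1)^{corank Sel_{2^∞}(V/ℚ)} = w(V)`,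
which is Monsky's theorem [Monsky 1996, Math. Z. 221, Thm. 1.5; = Dokchitser–Dokchitser 2010 Thm. 1.4 at p = 2].  The tree's named fact
`Literature.NumberTheory.EllipticCurves.monsky_selmerCorank_two_mod_two_eq` is typed in the ANALYTIC form `s₂(V) ≡ r_an(V) (mod 2)`, so the
passage to the root-number form uses the functional-equation parity `w(V) = (-1)^{r_an(V)}`, a tree theorem GIVEN modularity
(`p_parity_of_selmerCorank_mod_two_eq_of_exists_isNewformOf`).  Stubs: MODULARITY = route item `ModularityExistsNewform` (print item,
BCDT 2001 Thm. A) BY NAME; MONSKY = the named Literature fact (print, UNPROVED in the tree: a `def … : Prop` used as hypothesis elsewhere).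
Composition PROVED.  Sorries ONLY inside `stub_*`; nothing is asserted.
-/

set_option autoImplicit false
set_option linter.dupNamespace false

namespace Summit.BirchSwinnertonDyer.BirchSwinnertonDyer.Cruxes.TwoParityDD.MonskyByname

open Literature.NumberTheory.EllipticCurves
open Summit.BirchSwinnertonDyer.BirchSwinnertonDyer.Theses.GenusKolyvaginAtTwo (TwoParityDD ModularityExistsNewform)

/-- [print · ITEM BY NAME `ModularityExistsNewform`] every E/ℚ has an attached weight-2 newform (Wiles, Taylor–Wiles, BCDT 2001 Thm. A).
[cite: BCDTJAMS2001, Thm. A] -/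
theorem stub_modularity : ModularityExistsNewform := by
  sorry

/-- [print · NAMED LITERATURE FACT `monsky_selmerCorank_two_mod_two_eq` (unproved in the tree)] Monsky 1996: `corank Sel_{2^∞}(E/ℚ) ≡ r_an(E) (mod 2)`
for every E/ℚ (root-number form + functional equation). [cite: Monsky1996MathZ, Thm. 1.5] [cite: DokchitserDokchitserAnnals2010, §4.6 (case p = 2)] -/
theorem stub_monsky : monsky_selmerCorank_two_mod_two_eq := by
  sorry

/-- **Composition (kernel-checked): `TwoParityDD`** (item 23327) BY NAME from MODULARITY and MONSKY, via the tree's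
`p_parity_of_selmerCorank_mod_two_eq_of_exists_isNewformOf`. [cite: DokchitserDokchitserAnnals2010, Thm. 1.4] [cite: Monsky1996MathZ, Thm. 1.5] -/
theorem TwoParityDD_of : TwoParityDD := by
  intro V _
  haveI : Fact (Nat.Prime 2) := ⟨Nat.prime_two⟩
  exact p_parity_of_selmerCorank_mod_two_eq_of_exists_isNewformOf V 2 stub_modularity (stub_monsky V)

end Summit.BirchSwinnertonDyer.BirchSwinnertonDyer.Cruxes.TwoParityDD.MonskyByname
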